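import Summits.CriticalPhenomena.CardyFormulaZ2.Theorems.CardyUniqueLimitCardyRigidityExplorationULC
import Mathlib.Analysis.Normed.Affine.Convex
import Mathlib.Analysis.Convex.PathConnected
import HarnessLib

/-!
# Touching closes fjords: the deterministic reduction for the regularity of the explored slit domains

Crux `Summit.CriticalPhenomena.CardyFormulaZ2.Theses.CardyUniqueLimit.CardyRigidity`
(stmt-CriticalPhenomena-0746), line `crossing_martingale`, in support of the registered stub A3b
`stub_slitObservableApprox` (NOT proved here).  Companion to
`…CardyUniqueLimitCardyRigidityExplorationULC.lean` (vocabulary `Regularity.ULC / ULCOff /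
prefixPolyline / obstacle / slitComponent / tip / fjordEvent / PercExplorationULC`).  This file
proves the DETERMINISTIC half of Camia–Newman's "close encounters are touchings" (PTRF 139
(2007), §6, proof of Lemma 6.2, and the first case of the proof of Lemma 7.1): a close pair of
frontier points of a slit component is harmless as soon as the exploration between (the core
points of) the pair stays in the `ε`-ball, or touches itself or the boundary inside the ball;
equivalently, a FJORD forces an EXCURSION of the exploration out of the `ε`-ball between two
visits of the `ε''`-ball, without a touching of the two visits inside the ball.

* `Regularity.SetULC`, `ULC.of_setULC` — the classical form of uniform local connectedness for a
  set and its relation to the `hlc` form;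
* `Regularity.core D n ω = range (prefixPolyline D n ω) ∪ (D.Ω)ᶜ` and `prefixPath D n ω : ℝ → ℂ`
  (the prefix polyline extended constantly outside `[0, 1]`); `obstacle D η n ω` is the closed
  `η`-thickening of the core, every point of the obstacle is within `η` of a core point
  (`exists_mem_core_dist_le`) and the segment to it lies in the obstacle;
* ARCS `prefixPath D n ω '' uIcc s t` are compact connected subsets of the obstacle through the
  two polyline points (`exists_continuum_of_arc_subset`);
* TOUCHING LEMMAS: two arcs whose far ends are `2η`-close are joined inside the obstacle by the
  segment between the ends (`exists_continuum_of_touch`); an arc whose end is `2η`-close to a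
  point of `Ωᶜ` is joined to any continuum of `Ωᶜ` through that point
  (`exists_continuum_of_boundary_touch`);
* TRANSFER to frontier points (`exists_continuum_of_core`): a continuum of the obstacle through
  core points `η`-close to `a, b` extends by two segments to a continuum of the complement of
  any slit component through `a, b`, inside the same ball;
* THE REDUCTION (`exists_far_of_no_continuum`): if the pair `(a, b)` of points `η`-close to the
  polyline points of parameters `s, t` admits no continuum of the complement of a slit component
  inside `closedBall a ε`, then the exploration between `s` and `t` leaves `closedBall a ε`.

References: F. Camia, C. M. Newman, Probab. Theory Relat. Fields 139 (2007), proofs of Lemmas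
6.2 and 7.1 [CamiaNewman2007]; Ch. Pommerenke, *Boundary Behaviour of Conformal Maps* (1992),
§2.2 [PommerenkeBBCM1992].
-/

noncomputable section

open MeasureTheory Set Metric Filter Topology
open Literature.Probability Literature.Probability.LatticeModels Literature.Probability.Percolation
open Literature.Probability.LatticeModels.DiscreteDobrushin

namespace Summit.CriticalPhenomena.CardyFormulaZ2.Cruxes.CardyRigidity.CrossingMartingale

namespace Regularity

/-! ### The classical form of uniform local connectedness -/

/-- **`(ε'', ε)`-uniform local connectedness of a set**, classical form: any two points of `S`
at distance `< ε''` lie on a compact connected subset of `S` of diameter `≤ ε`.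
[cite: PommerenkeBBCM1992, §2.2] -/
def SetULC (ε'' ε : ℝ) (S : Set ℂ) : Prop :=
  ∀ a ∈ S, ∀ b ∈ S, dist a b < ε'' →
    ∃ E ⊆ S, IsCompact E ∧ IsPreconnected E ∧ a ∈ E ∧ b ∈ E ∧ Metric.diam E ≤ ε

/-- **The classical form implies the `hlc` form**: if the complement of an open set `U` is
`(ε'', ε)`-uniformly locally connected as a set, then `U` satisfies `ULC ε'' ε` (frontier points
of an open set lie in its complement; a set of diameter `≤ ε` through `a` lies in
`closedBall a ε`). [cite: PommerenkeBBCM1992, §2.2] -/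
theorem ULC.of_setULC {ε'' ε : ℝ} {U : Set ℂ} (hU : IsOpen U) (h : SetULC ε'' ε Uᶜ) :
    ULC ε'' ε U := by
  have hfr : frontier U ⊆ Uᶜ := by
    rw [hU.frontier_eq]
    exact fun x hx h' ↦ hx.2 h'
  intro a ha b hb hab
  obtain ⟨E, hEU, hEc, hEp, haE, hbE, hdiam⟩ := h a (hfr ha) b (hfr hb) hab
  refine ⟨E, hEU, hEc, hEp, haE, hbE, fun x hx ↦ ?_⟩
  rw [mem_closedBall]
  exact (dist_le_diam_of_mem hEc.isBounded hx haE).trans hdiam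

/-- The `hlc` clause off `V` for `U` follows from the classical form for `Uᶜ`. [cite: PommerenkeBBCM1992, §2.2] -/
theorem ULCOff.of_setULC {ε'' ε : ℝ} {U : Set ℂ} (hU : IsOpen U) (h : SetULC ε'' ε Uᶜ) (V : Set ℂ) :
    ULCOff ε'' ε U V :=
  (ULC.of_setULC hU h).ulcOff V

/-! ### The core of the obstacle and the extended prefix path -/

variable (D : DiscreteDobrushin)

/-- **The core** of the obstacle of depth `n`: the trace of the prefix polyline together with the
complement of the continuum domain (the obstacle is its closed `η`-thickening). [cite: CamiaNewman2007, §6] -/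
def core (n : ℕ) (ω : BondConfig (Site 2)) : Set ℂ :=
  range (prefixPolyline D n ω) ∪ (D.Ω)ᶜ

/-- **The extended prefix path**: the prefix polyline as a map `ℝ → ℂ`, constant outside `[0, 1]`
(so that arcs between two parameters are images of real intervals). [cite: CamiaNewman2007, §6] -/
def prefixPath (n : ℕ) (ω : BondConfig (Site 2)) : ℝ → ℂ :=
  IccExtend zero_le_one (prefixPolyline D n ω)

variable {D}

/-- The obstacle is the closed thickening of the core (by definition). [folklore] -/
theorem obstacle_eq_cthickening_core (η : ℝ) (n : ℕ) (ω : BondConfig (Site 2)) :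
    obstacle D η n ω = cthickening η (core D n ω) :=
  rfl

/-- The core is closed when the continuum domain is open. [folklore] -/
theorem isClosed_core (hΩ : IsOpen D.Ω) (n : ℕ) (ω : BondConfig (Site 2)) : IsClosed (core D n ω) :=
  (isCompact_range_prefixPolyline n ω).isClosed.union hΩ.isClosed_compl

/-- The core is part of the obstacle. [folklore] -/
theorem core_subset_obstacle (η : ℝ) (n : ℕ) (ω : BondConfig (Site 2)) : core D n ω ⊆ obstacle D η n ω :=
  self_subset_cthickening _

/-- Without thickening and for an open continuum domain, the obstacle is the core. [folklore] -/
theorem obstacle_zero (hΩ : IsOpen D.Ω) (n : ℕ) (ω : BondConfig (Site 2)) : obstacle D 0 n ω = core D n ω := by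
  rw [obstacle_eq_cthickening_core, cthickening_zero]
  exact (isClosed_core hΩ n ω).closure_eq

/-- **Every point of the obstacle is within `η` of a core point** (open domain, `η ≥ 0`).
[folklore] -/
theorem exists_mem_core_dist_le (hΩ : IsOpen D.Ω) {η : ℝ} (hη : 0 ≤ η) {n : ℕ} {ω : BondConfig (Site 2)}
    {x : ℂ} (hx : x ∈ obstacle D η n ω) : ∃ x₀ ∈ core D n ω, dist x x₀ ≤ η := by
  rw [obstacle_eq_cthickening_core, (isClosed_core hΩ n ω).cthickening_eq_biUnion_closedBall hη] at hx
  simpa only [mem_iUnion, mem_closedBall, exists_prop] using hx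

/-- A point within `η` of a core point lies on the obstacle. [folklore] -/
theorem mem_obstacle_of_dist_core_le {η : ℝ} {n : ℕ} {ω : BondConfig (Site 2)} {x x₀ : ℂ}
    (hx₀ : x₀ ∈ core D n ω) (h : dist x x₀ ≤ η) : x ∈ obstacle D η n ω :=
  mem_cthickening_of_dist_le x x₀ η _ hx₀ h

/-- **The segment from a point to an `η`-close core point lies on the obstacle.** [folklore] -/
theorem segment_subset_obstacle_of_dist_le {η : ℝ} {n : ℕ} {ω : BondConfig (Site 2)} {x x₀ : ℂ}
    (hx₀ : x₀ ∈ core D n ω) (h : dist x x₀ ≤ η) : segment ℝ x x₀ ⊆ obstacle D η n ω := by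
  intro y hy
  refine mem_obstacle_of_dist_core_le hx₀ ?_
  have := dist_add_dist_of_mem_segment hy
  linarith [dist_nonneg (x := x) (y := y)]

/-- The extended prefix path is continuous. [folklore] -/
theorem continuous_prefixPath (n : ℕ) (ω : BondConfig (Site 2)) : Continuous (prefixPath D n ω) :=
  (prefixPolyline D n ω).continuous.Icc_extend'

/-- The extended prefix path has the same trace as the prefix polyline. [folklore] -/
theorem range_prefixPath (n : ℕ) (ω : BondConfig (Site 2)) :
    range (prefixPath D n ω) = range (prefixPolyline D n ω) :=
  IccExtend_range _ _

/-- On `[0, 1]` the extended prefix path is the prefix polyline. [folklore] -/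
theorem prefixPath_val (n : ℕ) (ω : BondConfig (Site 2)) (s : unitInterval) :
    prefixPath D n ω s = prefixPolyline D n ω s :=
  IccExtend_val _ _ _

/-- Points of the extended prefix path are core points. [folklore] -/
theorem prefixPath_mem_core (n : ℕ) (ω : BondConfig (Site 2)) (s : ℝ) : prefixPath D n ω s ∈ core D n ω :=
  Or.inl (by rw [← range_prefixPath]; exact ⟨s, rfl⟩)

/-! ### Arcs of the prefix polyline are continua of the obstacle -/

/-- **An arc of the prefix polyline between two parameters is a compact connected subset of the
obstacle through the two points**; if it lies in a ball, it is a witness continuum inside that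
ball. [cite: CamiaNewman2007, §6 (proof of Lemma 6.2)] -/
theorem exists_continuum_of_arc_subset {η : ℝ} {n : ℕ} {ω : BondConfig (Site 2)} {s t : ℝ} {B : Set ℂ}
    (h : prefixPath D n ω '' uIcc s t ⊆ B) :
    ∃ τ ⊆ obstacle D η n ω, IsCompact τ ∧ IsPreconnected τ ∧ prefixPath D n ω s ∈ τ ∧
      prefixPath D n ω t ∈ τ ∧ τ ⊆ B :=
  ⟨prefixPath D n ω '' uIcc s t,
    (image_subset_range _ _).trans ((range_prefixPath n ω).le.trans (range_prefixPolyline_subset_obstacle η n ω)),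
    isCompact_uIcc.image (continuous_prefixPath n ω),
    isPreconnected_uIcc.image _ (continuous_prefixPath n ω).continuousOn,
    mem_image_of_mem _ left_mem_uIcc, mem_image_of_mem _ right_mem_uIcc, h⟩

/-- The segment between two `2η`-close points of the core lies on the obstacle (each of its points
is within `η` of the nearer end). [folklore] -/
theorem segment_subset_obstacle_of_dist_le_two_mul {η : ℝ} {n : ℕ} {ω : BondConfig (Site 2)} {x y : ℂ}
    (hx : x ∈ core D n ω) (hy : y ∈ core D n ω) (h : dist x y ≤ 2 * η) :
    segment ℝ x y ⊆ obstacle D η n ω := by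
  intro z hz
  have hsum := dist_add_dist_of_mem_segment hz
  by_cases hzx : dist x z ≤ η
  · exact mem_obstacle_of_dist_core_le hx (by rwa [dist_comm])
  · exact mem_obstacle_of_dist_core_le hy (by push Not at hzx; linarith)

/-- **Touching closes the fjord (self-touching).**  If the arc from `s` to `u₁` and the arc from
`u₂` to `t` both lie in a convex set `B`, and the polyline points of parameters `u₁, u₂` are
`2η`-close (the two tubes meet), then the obstacle contains a compact connected set through the
points of parameters `s` and `t` inside `B`: the two arcs and the segment between their ends.
[cite: CamiaNewman2007, §6 (proof of Lemma 6.2)] -/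
theorem exists_continuum_of_touch {η : ℝ} {n : ℕ} {ω : BondConfig (Site 2)} {s u₁ u₂ t : ℝ}
    {B : Set ℂ} (hB : Convex ℝ B) (h₁ : prefixPath D n ω '' uIcc s u₁ ⊆ B)
    (h₂ : prefixPath D n ω '' uIcc u₂ t ⊆ B)
    (hd : dist (prefixPath D n ω u₁) (prefixPath D n ω u₂) ≤ 2 * η) :
    ∃ τ ⊆ obstacle D η n ω, IsCompact τ ∧ IsPreconnected τ ∧ prefixPath D n ω s ∈ τ ∧
      prefixPath D n ω t ∈ τ ∧ τ ⊆ B := by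
  set p := prefixPath D n ω with hp
  obtain ⟨τ₁, hτ₁O, hτ₁c, hτ₁p, hs₁, hu₁, hτ₁B⟩ := exists_continuum_of_arc_subset (η := η) h₁
  obtain ⟨τ₂, hτ₂O, hτ₂c, hτ₂p, hu₂, ht₂, hτ₂B⟩ := exists_continuum_of_arc_subset (η := η) h₂
  have hu₁B : p u₁ ∈ B := hτ₁B hu₁
  have hu₂B : p u₂ ∈ B := hτ₂B hu₂
  refine ⟨τ₁ ∪ segment ℝ (p u₁) (p u₂) ∪ τ₂, ?_, ?_, ?_, Or.inl (Or.inl hs₁), Or.inr ht₂, ?_⟩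
  · exact union_subset (union_subset hτ₁O (segment_subset_obstacle_of_dist_le_two_mul
      (prefixPath_mem_core n ω u₁) (prefixPath_mem_core n ω u₂) hd)) hτ₂O
  · rw [← Path.range_segment]
    exact (hτ₁c.union (isCompact_range (Path.segment (p u₁) (p u₂)).continuous)).union hτ₂c
  · refine (hτ₁p.union (p u₁) hu₁ (left_mem_segment _ _ _) ?_).union (p u₂)
      (Or.inr (right_mem_segment _ _ _)) hu₂ hτ₂p
    rw [← Path.range_segment]
    exact isPreconnected_range (Path.segment (p u₁) (p u₂)).continuous
  · exact union_subset (union_subset hτ₁B (hB.segment_subset hu₁B hu₂B)) hτ₂B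

/-- **Touching closes the fjord (boundary touching).**  If the arc from `s` to `u` lies in a
convex set `B`, the polyline point of parameter `u` is `2η`-close to a point `y ∉ D.Ω`, and `τ₀`
is a compact connected subset of `(D.Ω)ᶜ` through `y` and `b₀` inside `B`, then the obstacle
contains a compact connected set through the point of parameter `s` and `b₀` inside `B`.
[cite: CamiaNewman2007, §7 (proof of Lemma 7.1, first case)] -/
theorem exists_continuum_of_boundary_touch {η : ℝ} {n : ℕ} {ω : BondConfig (Site 2)} {s u : ℝ}
    {B : Set ℂ} (hB : Convex ℝ B) (h₁ : prefixPath D n ω '' uIcc s u ⊆ B) {y b₀ : ℂ} (hy : y ∉ D.Ω)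
    (hd : dist (prefixPath D n ω u) y ≤ 2 * η) {τ₀ : Set ℂ} (hτ₀ : τ₀ ⊆ (D.Ω)ᶜ) (hτ₀c : IsCompact τ₀)
    (hτ₀p : IsPreconnected τ₀) (hyτ₀ : y ∈ τ₀) (hb₀ : b₀ ∈ τ₀) (hτ₀B : τ₀ ⊆ B) :
    ∃ τ ⊆ obstacle D η n ω, IsCompact τ ∧ IsPreconnected τ ∧ prefixPath D n ω s ∈ τ ∧ b₀ ∈ τ ∧ τ ⊆ B := by
  set p := prefixPath D n ω with hp
  obtain ⟨τ₁, hτ₁O, hτ₁c, hτ₁p, hs₁, hu₁, hτ₁B⟩ := exists_continuum_of_arc_subset (η := η) h₁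
  have huB : p u ∈ B := hτ₁B hu₁
  have hyc : y ∈ core D n ω := Or.inr hy
  refine ⟨τ₁ ∪ segment ℝ (p u) y ∪ τ₀, ?_, ?_, ?_, Or.inl (Or.inl hs₁), Or.inr hb₀, ?_⟩
  · exact union_subset (union_subset hτ₁O (segment_subset_obstacle_of_dist_le_two_mul
      (prefixPath_mem_core n ω u) hyc hd)) (hτ₀.trans (compl_subset_obstacle η n ω))
  · rw [← Path.range_segment]
    exact (hτ₁c.union (isCompact_range (Path.segment (p u) y).continuous)).union hτ₀c
  · refine (hτ₁p.union (p u) hu₁ (left_mem_segment _ _ _) ?_).union y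
      (Or.inr (right_mem_segment _ _ _)) hyτ₀ hτ₀p
    rw [← Path.range_segment]
    exact isPreconnected_range (Path.segment (p u) y).continuous
  · exact union_subset (union_subset hτ₁B (hB.segment_subset huB (hτ₀B hyτ₀))) hτ₀B

/-! ### Transfer to the frontier points of a slit component -/

/-- **From core points to arbitrary points of the obstacle.**  Let `U` avoid the obstacle (e.g. a
slit component).  A compact connected subset `τ` of the obstacle through core points `a₀, b₀`
that are `η`-close to `a, b`, inside a convex set `B` containing `a` and `b`, extends by the two
segments `[a, a₀]`, `[b₀, b]` to a compact connected subset of `Uᶜ` through `a` and `b` inside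
`B`. [cite: CamiaNewman2007, §6 (proof of Lemma 6.2)] -/
theorem exists_continuum_of_core {η : ℝ} {n : ℕ} {ω : BondConfig (Site 2)} {U : Set ℂ}
    (hU : U ⊆ (obstacle D η n ω)ᶜ) {a b a₀ b₀ : ℂ} {B : Set ℂ} (hB : Convex ℝ B) (haB : a ∈ B)
    (hbB : b ∈ B) (ha₀ : a₀ ∈ core D n ω) (hb₀ : b₀ ∈ core D n ω) (ha : dist a a₀ ≤ η)
    (hb : dist b b₀ ≤ η) {τ : Set ℂ} (hτO : τ ⊆ obstacle D η n ω) (hτc : IsCompact τ)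
    (hτp : IsPreconnected τ) (ha₀τ : a₀ ∈ τ) (hb₀τ : b₀ ∈ τ) (hτB : τ ⊆ B) :
    ∃ σ ⊆ Uᶜ, IsCompact σ ∧ IsPreconnected σ ∧ a ∈ σ ∧ b ∈ σ ∧ σ ⊆ B := by
  have hOU : obstacle D η n ω ⊆ Uᶜ := subset_compl_comm.1 hU
  refine ⟨segment ℝ a a₀ ∪ τ ∪ segment ℝ b b₀, ?_, ?_, ?_, Or.inl (Or.inl (left_mem_segment _ _ _)),
    Or.inr (left_mem_segment _ _ _), ?_⟩
  · exact union_subset (union_subset ((segment_subset_obstacle_of_dist_le ha₀ ha).trans hOU)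
      (hτO.trans hOU)) ((segment_subset_obstacle_of_dist_le hb₀ hb).trans hOU)
  · rw [← Path.range_segment a a₀, ← Path.range_segment b b₀]
    exact ((isCompact_range (Path.segment a a₀).continuous).union hτc).union
      (isCompact_range (Path.segment b b₀).continuous)
  · have h1 : IsPreconnected (segment ℝ a a₀) := by
      rw [← Path.range_segment]; exact isPreconnected_range (Path.segment a a₀).continuous
    have h2 : IsPreconnected (segment ℝ b b₀) := by
      rw [← Path.range_segment]; exact isPreconnected_range (Path.segment b b₀).continuous
    exact (h1.union a₀ (right_mem_segment _ _ _) ha₀τ hτp).union b₀ (Or.inr hb₀τ)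
      (right_mem_segment _ _ _) h2
  · exact union_subset (union_subset (hB.segment_subset haB (hτB ha₀τ)) hτB)
      (hB.segment_subset hbB (hτB hb₀τ))

/-- **Frontier points of a slit component have `η`-close core points** (open domain, `η ≥ 0`).
[folklore] -/
theorem exists_mem_core_of_mem_frontier (hΩ : IsOpen D.Ω) {η : ℝ} (hη : 0 ≤ η) {n : ℕ}
    {ω : BondConfig (Site 2)} {z a : ℂ} (ha : a ∈ frontier (slitComponent D η n ω z)) :
    ∃ a₀ ∈ core D n ω, dist a a₀ ≤ η :=
  exists_mem_core_dist_le hΩ hη (frontier_slitComponent_subset η n ω z ha).1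

/-! ### The reduction: a fjord forces an excursion without touching -/

/-- **A fjord between two visits forces an excursion** (the deterministic reduction behind
Camia–Newman's Lemma 6.2/7.1 for the slit components).  Let `a, b` be `η`-close to the
polyline points of parameters `s, t`, with `dist a b ≤ ε`.  If NO compact connected subset of the
complement of the slit component `slitComponent D η n ω z` through `a` and `b` lies in
`closedBall a ε`, then the exploration between the parameters `s` and `t` leaves that ball.
[cite: CamiaNewman2007, §6 (proof of Lemma 6.2)] -/
theorem exists_far_of_no_continuum {η ε : ℝ} {n : ℕ} {ω : BondConfig (Site 2)} {z a b : ℂ} {s t : ℝ}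
    (ha : dist a (prefixPath D n ω s) ≤ η) (hb : dist b (prefixPath D n ω t) ≤ η) (hab : dist a b ≤ ε)
    (hbad : ¬ ∃ σ ⊆ (slitComponent D η n ω z)ᶜ, IsCompact σ ∧ IsPreconnected σ ∧ a ∈ σ ∧ b ∈ σ ∧
      σ ⊆ closedBall a ε) :
    ∃ u ∈ uIcc s t, ε < dist (prefixPath D n ω u) a := by
  by_contra hfar
  push Not at hfar
  have harc : prefixPath D n ω '' uIcc s t ⊆ closedBall a ε := by
    rintro _ ⟨u, hu, rfl⟩
    exact mem_closedBall.2 (hfar u hu)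
  obtain ⟨τ, hτO, hτc, hτp, hs, ht, hτB⟩ := exists_continuum_of_arc_subset (η := η) harc
  have hε : 0 ≤ ε := dist_nonneg.trans hab
  exact hbad (exists_continuum_of_core (slitComponent_subset_compl η n ω z) (convex_closedBall a ε)
    (mem_closedBall_self hε) (mem_closedBall'.2 hab)
    (prefixPath_mem_core n ω s) (prefixPath_mem_core n ω t) ha hb hτO hτc hτp hs ht hτB)

/-- **A fjord between two visits is not closed by a touching of the visits**: under the
hypotheses of `exists_far_of_no_continuum`, there are no parameters `u₁, u₂` such that the arcs
from `s` to `u₁` and from `u₂` to `t` stay in `closedBall a ε` while the polyline points of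
parameters `u₁, u₂` are `2η`-close. [cite: CamiaNewman2007, §6 (proof of Lemma 6.2)] -/
theorem not_touch_of_no_continuum {η ε : ℝ} {n : ℕ} {ω : BondConfig (Site 2)} {z a b : ℂ}
    {s t u₁ u₂ : ℝ} (ha : dist a (prefixPath D n ω s) ≤ η) (hb : dist b (prefixPath D n ω t) ≤ η)
    (hab : dist a b ≤ ε)
    (hbad : ¬ ∃ σ ⊆ (slitComponent D η n ω z)ᶜ, IsCompact σ ∧ IsPreconnected σ ∧ a ∈ σ ∧ b ∈ σ ∧
      σ ⊆ closedBall a ε)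
    (h₁ : prefixPath D n ω '' uIcc s u₁ ⊆ closedBall a ε)
    (h₂ : prefixPath D n ω '' uIcc u₂ t ⊆ closedBall a ε) :
    2 * η < dist (prefixPath D n ω u₁) (prefixPath D n ω u₂) := by
  by_contra hd
  push Not at hd
  obtain ⟨τ, hτO, hτc, hτp, hs, ht, hτB⟩ := exists_continuum_of_touch (convex_closedBall a ε) h₁ h₂ hd
  have hε : 0 ≤ ε := dist_nonneg.trans hab
  exact hbad (exists_continuum_of_core (slitComponent_subset_compl η n ω z) (convex_closedBall a ε)
    (mem_closedBall_self hε) (mem_closedBall'.2 hab)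
    (prefixPath_mem_core n ω s) (prefixPath_mem_core n ω t) ha hb hτO hτc hτp hs ht hτB)

end Regularity

/-- **Registered form** (anchor `regularity_exists_far_of_no_continuum` of stmt-CriticalPhenomena-0746): a fjord of a
slit component between two points `η`-close to the exploration polyline at parameters `s, t` forces the exploration
between `s` and `t` to leave the `ε`-ball (Camia–Newman's reduction of close encounters to double crossings).
[cite: CamiaNewman2007, §6 (proof of Lemma 6.2)] -/
theorem regularity_exists_far_of_no_continuum : ∀ {D : Literature.Probability.LatticeModels.DiscreteDobrushin} {η ε : ℝ} {n : ℕ} {ω : Literature.Probability.Percolation.BondConfig (Literature.Probability.LatticeModels.Site 2)} {z a b : ℂ} {s t : ℝ}, dist a (Summit.CriticalPhenomena.CardyFormulaZ2.Cruxes.CardyRigidity.CrossingMartingale.Regularity.prefixPath D n ω s) ≤ η → dist b (Summit.CriticalPhenomena.CardyFormulaZ2.Cruxes.CardyRigidity.CrossingMartingale.Regularity.prefixPath D n ω t) ≤ η → dist a b ≤ ε → (¬ ∃ σ ⊆ (Summit.CriticalPhenomena.CardyFormulaZ2.Cruxes.CardyRigidity.CrossingMartingale.Regularity.slitComponent D η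 n ω z)ᶜ, IsCompact σ ∧ IsPreconnected σ ∧ a ∈ σ ∧ b ∈ σ ∧ σ ⊆ Metric.closedBall a ε) → ∃ u ∈ Set.uIcc s t, ε < dist (Summit.CriticalPhenomena.CardyFormulaZ2.Cruxes.CardyRigidity.CrossingMartingale.Regularity.prefixPath D n ω u) a :=
  Regularity.exists_far_of_no_continuum

end Summit.CriticalPhenomena.CardyFormulaZ2.Cruxes.CardyRigidity.CrossingMartingale

end
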